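import Mathlib.GroupTheory.Perm.Cycle.Concrete
import Mathlib.GroupTheory.Perm.Cycle.Type
import Mathlib.GroupTheory.SpecificGroups.Alternating
import Literature.NumberTheory.DiophantineGeometry.BcgpResiduallyA5bModular
import Literature.NumberTheory.Automorphic.IsAutomorphicAE
import HarnessLib

/-!
# Venture ResidMod — the MOD-2 flag: a certificate of shape "rational Weierstrass point ∧ Frobenius of
# order 5 ∧ Frobenius of order 3 or 6 ∧ one real Weierstrass point" feeds Boxer–Calegari–Gee–Pilloni
# 2025, Thm. 8.3.2 (residually `A₅(b)` abelian surfaces over `ℚ` are modular)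

HONEST FRAMING. Interface file of a COMPUTATION cell (`pub-residmod`: census of mod-`ℓ` Galois images
of genus-2 Jacobians in the LMFDB range). NO modularity is claimed here for any particular surface and
NO image is computed here: every datum about a surface is a binder, and the cited theorem is the tree's
named fact `Literature.NumberTheory.DiophantineGeometry.bcgp_residuallyA5b_modular_abelianSurface`
(Boxer–Calegari–Gee–Pilloni, *Modularity theorems for abelian surfaces*, arXiv:2502.20645, Thm. 8.3.2,
typed in `Literature/NumberTheory/DiophantineGeometry/BcgpResiduallyA5bModular.lean`), taken as a
hypothesis `(h832 : …)` — so every theorem below is an IMPLICATION, conditional on that published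
theorem (which in print depends on Arthur's classification for `GSp₄`). What the kernel checks is the
finite group theory of `S₅` that turns a census certificate into hypotheses (1)–(2) of Thm. 8.3.2.

THE PRINTED THEOREM (loc. cit. p. 124, verbatim in the docstring of the named fact): "Suppose that
`A/ℚ` is an abelian surface such that (1) `A₅(b) ⊆ ρ̄_{A,2}(G_ℚ) ⊆ S₅(b)`. (2) The image of complex
conjugation has order `2` and lands in `A₅(b)`. (3) `A` has good ordinary or semistable reduction at
`2`, and `ρ_{A,2}|_{G_{ℚ₂}}` is ordinary and `2`-distinguished. Then `A` is modular."

THE CERTIFICATE SHAPE (what the cell's engines produce per flagged surface `A = Jac(X)`):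
* `WeierstrassTwoTorsionFrame A` — MODELLING BINDER (hypothesis structure, D-0014): an additive frame
  `e : A[2](ℚ̄) ≃ (ℤ/2)⁴` and a homomorphism `perm : Γ_ℚ → S₅` with `e (g • P) = s5bMatrix (perm g) · e P`.
  Source: loc. cit. §8.1 — for `X : y² = f(x)`, `A[2]` is spanned by differences of Weierstrass points,
  `A[2] ≅ U⁰/L` with `S₆` permuting the six Weierstrass points, and "`X` has a rational Weierstrass
  point if and only if `ρ̄_{A,2}` factors through a conjugate of `S₅(b)`"; `s5bMatrix σ` (tree,
  `GenusTwoTwoTorsionS5b.lean`) is the matrix of `σ ∈ S₅(b) = Stab(6)` on `U⁰/L` in the frame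
  `u_i = [δ_i + δ₆]`, so `perm g` is the permutation of the five non-rational Weierstrass points induced
  by `g`. The tree has no Jacobians, so this is not constructible in the kernel today: it is the claim
  "this LMFDB curve has a rational Weierstrass point and `A` is its Jacobian", vouched for by the cell.
* `h5 : ∃ g, (perm g)⁵ = 1 ∧ perm g ≠ 1` and `h36 : ∃ g, (perm g)⁶ = 1 ∧ (perm g)² ≠ 1` — a Frobenius
  whose cycle type on the quintic's roots is `(5)`, resp. contains a `3`-cycle (Dedekind: factorization
  pattern of the quintic mod a good prime; equivalently `(a_q, b_q)` both odd, resp. `a_q` odd and `b_q`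
  even, in the Euler factor `L_q(A,T)` — the Euler-factor form is the object of the companion file
  `Mod2A5bEulerCertificate.lean`).
* `hcc : ∀ c complex conjugation, #support (perm c) = 4` — exactly ONE of the five finite Weierstrass
  points is real (a Sturm count on the quintic), so `c` is a double transposition.
* (3) is passed through VERBATIM in the tree's vocabulary (semistable-or-good reduction at `2` in Galois
  form; every framed dual of `V₂(A)` ordinary and `2`-distinguished at `v ∣ 2`,
  `FramedGaloisRep.IsOrdinaryPDistinguishedAt`, Def. 1.8.8): the cell certifies it from the Euler factor
  at `2` via loc. cit. Def. 9.1.2 ff. ("if `B` has good ordinary reduction, then `B` is `p`-distinguished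
  if and only if the characteristic polynomial `Q(x)` of `Frob_p` … is not a square"); that translation
  is a published lemma not yet in the tree and is NOT asserted here.

WHAT THE KERNEL CHECKS (§A–§B, standard axioms, `decide +kernel` on the `120` elements of `S₅` in the
style of `Literature/NumberTheory/FaltingsSerre/S6Subgroups.lean`):
* `alternatingGroup_le_of_orderFive_of_orderThreeSix` — a subgroup of `S₅` containing an element of
  order `5` and an element of order `3` or `6` contains `A₅` (every `5`-cycle is conjugate to
  `(0 1 2 3 4)` — `exists_conj_cyc5`; for each of the `40` elements `τ` of order `3` or `6`, `(0 1 2)` is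
  a word in `(0 1 2 3 4), τ` — table `wordsT`; the `60` even permutations are words in
  `(0 1 2 3 4), (0 1 2)` — table `wordsA5`). This is the classical fact that a transitive subgroup of
  `S₅` containing a `3`-cycle is `A₅` or `S₅`, here as a finite verification.
* `cycleType_eq_two_two_of_sq_eq_one` — an involution of `S₅` moving exactly four letters has cycle
  type `(2,2)` (Mathlib's `cycleType_prime_order`, `sum_cycleType`; no `decide`).
VERDICT: `modular_of_mod2Certificate` — binders ⟹ hypotheses (1)–(2) of Thm. 8.3.2 ⟹ (with (3) and
`h832`) `A` is modular in the tree's almost-everywhere `GL₄` sense: every framed dual `r` of every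
`V_p(A)` is `IsAutomorphicAE ι hcpt r` (an L-algebraic cuspidal `π` on `GL₄(𝔸_ℚ)` whose Satake
parameters give `det(X − r(Frob_v))` at almost all `v`).

References: [BoxerCalegariGeePilloni2025] arXiv:2502.20645, Thm. 8.3.2 p. 124, §8.1 (Lemma 8.1.1,
8.1.2), Def. 1.8.8, Def. 9.1.2; cell HOME `run/shared/lean/pub/pub-residmod/` (certificate format
`cert/CERT-FORMAT-v0.md`).
-/

namespace Summit.Ventures.ResidMod

open Equiv Equiv.Perm

/-! ## A. Kernel facts about `S₅`: `⟨5-cycle, element of order 3 or 6⟩ ⊇ A₅` -/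

section S5

/-- The `5`-cycle `(0 1 2 3 4) ∈ S₅`. [folklore] -/
def cyc5 : Perm (Fin 5) := c[(0 : Fin 5), 1, 2, 3, 4]

/-- The `3`-cycle `(0 1 2) ∈ S₅`. [folklore] -/
def cyc3 : Perm (Fin 5) := c[(0 : Fin 5), 1, 2]

/-- The element of `S₅` denoted by a word `w` in letters `G` (product, left to right). [folklore] -/
def evalW {m : ℕ} (G : Fin m → Perm (Fin 5)) (w : List (Fin m)) : Perm (Fin 5) :=
  (w.map G).prod

/-- A word in letters taken from a subgroup lies in that subgroup. [folklore] -/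
theorem evalW_mem {m : ℕ} (H : Subgroup (Perm (Fin 5))) (G : Fin m → Perm (Fin 5))
    (hG : ∀ i, G i ∈ H) (w : List (Fin m)) : evalW G w ∈ H := by
  refine Subgroup.list_prod_mem _ fun x hx => ?_
  rw [List.mem_map] at hx
  obtain ⟨i, -, rfl⟩ := hx
  exact hG i

/-- A homomorphism evaluates words letterwise. [folklore] -/
theorem map_evalW {m : ℕ} {F : Type*} [FunLike F (Perm (Fin 5)) (Perm (Fin 5))]
    [MonoidHomClass F (Perm (Fin 5)) (Perm (Fin 5))] (f : F) (G : Fin m → Perm (Fin 5))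
    (w : List (Fin m)) : f (evalW G w) = evalW (⇑f ∘ G) w := by
  unfold evalW
  rw [map_list_prod, List.map_map]

/-- `f ∘ (a, b) = (f a, f b)`. [folklore] -/
theorem comp_vecCons₂ (f : Perm (Fin 5) → Perm (Fin 5)) (a b : Perm (Fin 5)) :
    f ∘ ![a, b] = ![f a, f b] := by
  ext i : 1
  fin_cases i <;> rfl

/-- KERNEL CHECK: every element of order `5` of `S₅` is conjugate to `(0 1 2 3 4)`. [folklore] -/
theorem exists_conj_cyc5 :
    ∀ σ : Perm (Fin 5), σ ^ 5 = 1 → σ ≠ 1 → ∃ g : Perm (Fin 5), g * cyc5 * g⁻¹ = σ := by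
  unfold cyc5
  decide +kernel

/-- For each element `τ ∈ S₅` of order `3` or `6`, one of these `32` words in `(0 1 2 3 4)` (letter `0`)
and `τ` (letter `1`) equals `(0 1 2)` (table found by breadth-first search; checked below). [folklore] -/
def wordsT : List (List (Fin 2)) :=
  [[0, 1, 1], [0, 1], [0, 0, 0, 0, 1, 0], [1, 0, 0, 1, 0], [1, 0, 1, 0, 0], [1, 0, 1, 0, 1],
   [1, 1, 0, 0, 1, 1, 0], [1, 0, 0, 0, 1], [0, 1, 1, 1, 1], [1], [1, 1, 1, 1], [0, 1, 0, 0, 1],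
   [1, 0, 1, 1, 1, 0, 0], [0, 1, 0, 0, 0, 0], [1, 1, 0, 1, 0, 1], [1, 1], [1, 0, 1, 0, 0, 0],
   [0, 0, 0, 1, 0, 1], [1, 0, 0, 1], [1, 0, 1, 0, 1, 1], [0, 0, 1, 0, 1, 0, 0], [0, 1, 1, 0, 0, 1, 1],
   [1, 0, 0, 0, 1, 1, 0, 0], [1, 1, 0], [0, 0, 1, 1, 1, 0, 1], [0, 0, 0, 1, 0, 1, 0], [0, 0, 1, 0, 1],
   [0, 1, 1, 1, 0, 1], [0, 0, 0, 1, 1, 0, 1, 1], [1, 0], [1, 1, 1, 1, 0], [1, 0, 1, 1, 1, 0]]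

/-- KERNEL CHECK: for every `τ ∈ S₅` with `τ⁶ = 1`, `τ² ≠ 1` (order `3` or `6`), `(0 1 2)` is a word in
`(0 1 2 3 4)` and `τ`, witnessed by `wordsT`. [folklore] -/
theorem cyc3_word_of_orderThreeSix :
    ∀ τ : Perm (Fin 5), τ ^ 6 = 1 → τ ^ 2 ≠ 1 → ∃ w ∈ wordsT, evalW ![cyc5, τ] w = cyc3 := by
  unfold wordsT evalW cyc5 cyc3
  decide +kernel

/-- The `60` even permutations of `S₅` as words in `(0 1 2 3 4)` (letter `0`) and `(0 1 2)` (letter `1`)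
— the classical generation `A₅ = ⟨(1 2 3), (1 2 3 4 5)⟩`, as a table. [folklore] -/
def wordsA5 : List (List (Fin 2)) :=
  [[], [0], [1], [0, 0], [0, 1], [1, 0], [1, 1], [0, 0, 0], [0, 0, 1], [0, 1, 0], [0, 1, 1], [1, 0, 0],
   [1, 0, 1], [1, 1, 0], [0, 0, 0, 0], [0, 0, 0, 1], [0, 0, 1, 0], [0, 0, 1, 1], [0, 1, 0, 0],
   [0, 1, 0, 1], [0, 1, 1, 0], [1, 0, 0, 0], [1, 0, 1, 0], [1, 0, 1, 1], [1, 1, 0, 0], [1, 1, 0, 1],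
   [0, 0, 0, 0, 1], [0, 0, 0, 1, 0], [0, 0, 1, 0, 1], [0, 0, 1, 1, 0], [0, 1, 0, 0, 0], [0, 1, 0, 1, 0],
   [0, 1, 0, 1, 1], [0, 1, 1, 0, 0], [0, 1, 1, 0, 1], [1, 0, 0, 0, 0], [1, 0, 0, 0, 1], [1, 0, 1, 0, 1],
   [1, 1, 0, 1, 0], [1, 1, 0, 1, 1], [0, 0, 0, 0, 1, 0], [0, 0, 0, 1, 0, 1], [0, 0, 1, 0, 1, 0],
   [0, 0, 1, 0, 1, 1], [0, 0, 1, 1, 0, 1], [0, 1, 0, 0, 0, 0], [0, 1, 0, 0, 0, 1], [0, 1, 1, 0, 1, 0],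
   [1, 0, 0, 0, 1, 0], [1, 0, 1, 0, 1, 1], [1, 1, 0, 1, 0, 1], [0, 0, 0, 0, 1, 0, 1],
   [0, 0, 0, 1, 0, 1, 0], [0, 0, 0, 1, 0, 1, 1], [0, 0, 1, 1, 0, 1, 0], [0, 1, 1, 0, 1, 0, 1],
   [1, 0, 0, 0, 1, 0, 1], [0, 0, 0, 0, 1, 0, 1, 0], [0, 0, 0, 0, 1, 0, 1, 1], [0, 0, 1, 1, 0, 1, 0, 1]]

/-- KERNEL CHECK: every even permutation of `S₅` is one of the `60` words of `wordsA5` in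
`(0 1 2 3 4)`, `(0 1 2)`. [folklore] -/
theorem wordsA5_complete :
    ∀ π : Perm (Fin 5), Perm.sign π = 1 → π ∈ wordsA5.map (evalW ![cyc5, cyc3]) := by
  unfold wordsA5 evalW cyc5 cyc3
  decide +kernel

/-- **A subgroup of `S₅` containing an element of order `5` and an element of order `3` or `6`
contains `A₅`** (equivalently: a transitive subgroup of `S₅` containing a `3`-cycle is `A₅` or `S₅`).
Finite verification: conjugate the `5`-cycle to `(0 1 2 3 4)`, produce `(0 1 2)` by `wordsT`, then all
of `A₅` by `wordsA5`, and conjugate back (`A₅` is normal). [folklore] -/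
theorem alternatingGroup_le_of_orderFive_of_orderThreeSix (H : Subgroup (Perm (Fin 5)))
    {σ τ : Perm (Fin 5)} (hσ : σ ∈ H) (hτ : τ ∈ H) (h5 : σ ^ 5 = 1) (h1 : σ ≠ 1) (h6 : τ ^ 6 = 1)
    (h2 : τ ^ 2 ≠ 1) : alternatingGroup (Fin 5) ≤ H := by
  obtain ⟨g, hg⟩ := exists_conj_cyc5 σ h5 h1
  -- `τ' = g⁻¹ τ g` has order `3` or `6`
  set τ' : Perm (Fin 5) := MulAut.conj g⁻¹ τ with hτ'
  have hgτ' : MulAut.conj g τ' = τ := by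
    rw [hτ', MulAut.conj_apply, MulAut.conj_apply, inv_inv]; group
  have hgc : MulAut.conj g cyc5 = σ := by rw [MulAut.conj_apply, hg]
  have h6' : τ' ^ 6 = 1 := by rw [hτ', ← map_pow, h6, map_one]
  have h2' : τ' ^ 2 ≠ 1 := by
    intro h
    apply h2
    rw [hτ', ← map_pow] at h
    exact (MulEquiv.map_eq_one_iff _).1 h
  obtain ⟨w, -, hw⟩ := cyc3_word_of_orderThreeSix τ' h6' h2'
  -- `g (0 1 2) g⁻¹` is a word in `σ, τ`, hence in `H`
  have hc3 : MulAut.conj g cyc3 = evalW ![σ, τ] w := by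
    rw [← hw, map_evalW (MulAut.conj g), comp_vecCons₂, hgτ', hgc]
  have hc3H : MulAut.conj g cyc3 ∈ H := by
    rw [hc3]
    exact evalW_mem H _ (fun i => by fin_cases i <;> assumption) w
  intro π hπ
  rw [Equiv.Perm.mem_alternatingGroup] at hπ
  -- `g⁻¹ π g` is even, hence a word in `(0 1 2 3 4), (0 1 2)`
  have hπ' : Perm.sign (MulAut.conj g⁻¹ π) = 1 := by
    rw [MulAut.conj_apply, map_mul, map_mul, hπ, mul_one, ← map_mul, inv_inv, inv_mul_cancel, map_one]
  have hmem := wordsA5_complete _ hπ'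
  rw [List.mem_map] at hmem
  obtain ⟨w', -, hw'⟩ := hmem
  have hπeq : π = MulAut.conj g (evalW ![cyc5, cyc3] w') := by
    rw [hw', MulAut.conj_apply, MulAut.conj_apply, inv_inv]; group
  rw [hπeq, map_evalW (MulAut.conj g), comp_vecCons₂, hgc]
  exact evalW_mem H _ (fun i => by fin_cases i <;> assumption) w'

/-- **An involution of `S₅` moving exactly four letters is a double transposition** (cycle type
`(2,2)`, the class `(**)(**)`): its order is the prime `2`, so its cycle type is `{2,…,2}`
(`cycleType_prime_order`) with sum `#support = 4` (`sum_cycleType`). [folklore] -/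
theorem cycleType_eq_two_two_of_sq_eq_one {σ : Perm (Fin 5)} (h2 : σ ^ 2 = 1)
    (hsupp : σ.support.card = 4) : σ.cycleType = {2, 2} := by
  have hne : σ ≠ 1 := by
    intro h
    rw [h, Equiv.Perm.support_one, Finset.card_empty] at hsupp
    exact absurd hsupp (by norm_num)
  haveI : Fact (Nat.Prime 2) := ⟨Nat.prime_two⟩
  have hord : orderOf σ = 2 := orderOf_eq_prime h2 hne
  obtain ⟨n, hn⟩ := Equiv.Perm.cycleType_prime_order (σ := σ) (by rw [hord]; exact Nat.prime_two)
  rw [hord] at hn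
  have hsum := Equiv.Perm.sum_cycleType σ
  rw [hn, Multiset.sum_replicate, smul_eq_mul, hsupp] at hsum
  have hn1 : n = 1 := by omega
  rw [hn, hn1]
  rfl

end S5

/-! ## B. The certificate contract and the verdict -/

section Certificate

open CategoryTheory IsDedekindDomain Field
open scoped NumberField Matrix
open Literature.NumberTheory.GaloisRepresentations Literature.NumberTheory.Automorphic
open Literature.NumberTheory.DiophantineGeometry
open Literature.AlgebraicGeometry.Motives (AbelianVariety)

/-- **Weierstrass frame of the `2`-torsion** (hypothesis structure, D-0014; the cell's MODELLING CLAIM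
for a flagged surface `A = Jac(X)`, `X` with a rational Weierstrass point): an additive frame
`e : A[2](ℚ̄) ≃ (ℤ/2)⁴` and a homomorphism `perm : Γ_ℚ → S₅` such that every `g ∈ Γ_ℚ` acts on `A[2]`
through `s5bMatrix (perm g)` — `perm g` being the permutation of the five non-rational Weierstrass
points induced by `g` ([BCGP 2025, §8.1]: `A[2] ≅ U⁰/L` spanned by differences of Weierstrass points;
"`X` has a rational Weierstrass point if and only if `ρ̄_{A,2}` factors through a conjugate of
`S₅(b)`"). Not constructible in the tree (no Jacobians); nothing here asserts an instance exists.
[cite: BoxerCalegariGeePilloni2025, §8.1 (A[2] = U⁰/L; S₅(b)); Lemma 8.1.2] -/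
structure WeierstrassTwoTorsionFrame (A : AbelianVariety ℚ) where
  /-- The additive frame `A[2](ℚ̄) ≃ (ℤ/2)⁴` (basis `u_i = [δ_i + δ₆]` of `U⁰/L`). -/
  e : A.geomTorsion (2 : ℕ) ≃+ (Fin 4 → ZMod 2)
  /-- The permutation action of `Γ_ℚ` on the five non-rational Weierstrass points. -/
  perm : absoluteGaloisGroup ℚ →* Perm (Fin 5)
  /-- `g` acts on `A[2]` by the `S₅(b)`-matrix of `perm g`. -/
  apply_smul : ∀ (g : absoluteGaloisGroup ℚ) (P : A.geomTorsion (2 : ℕ)),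
    e (g • P) = s5bMatrix (perm g) *ᵥ e P

variable {A : AbelianVariety ℚ}

/-- Hypothesis (1) of Thm. 8.3.2 from the certificate: in a Weierstrass frame the image lies in `S₅(b)`
(tautologically) and contains `A₅(b)` as soon as some `g` acts by a `5`-cycle and some `g'` by an element
of order `3` or `6` (`alternatingGroup_le_of_orderFive_of_orderThreeSix` applied to `im perm`).
[cite: BoxerCalegariGeePilloni2025, Thm. 8.3.2 (1)] -/
theorem hypothesisOne_of_frame (F : WeierstrassTwoTorsionFrame A)
    (h5 : ∃ g : absoluteGaloisGroup ℚ, F.perm g ^ 5 = 1 ∧ F.perm g ≠ 1)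
    (h36 : ∃ g : absoluteGaloisGroup ℚ, F.perm g ^ 6 = 1 ∧ F.perm g ^ 2 ≠ 1) :
    (∀ g : absoluteGaloisGroup ℚ, ∃ σ : Perm (Fin 5),
        ∀ P : A.geomTorsion (2 : ℕ), F.e (g • P) = s5bMatrix σ *ᵥ F.e P) ∧
      (∀ σ : Perm (Fin 5), Perm.sign σ = 1 →
        ∃ g : absoluteGaloisGroup ℚ,
          ∀ P : A.geomTorsion (2 : ℕ), F.e (g • P) = s5bMatrix σ *ᵥ F.e P) := by
  refine ⟨fun g => ⟨F.perm g, F.apply_smul g⟩, fun σ hσ => ?_⟩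
  obtain ⟨g₅, h5a, h5b⟩ := h5
  obtain ⟨g₃, h3a, h3b⟩ := h36
  have hle := alternatingGroup_le_of_orderFive_of_orderThreeSix F.perm.range ⟨g₅, rfl⟩ ⟨g₃, rfl⟩
    h5a h5b h3a h3b
  obtain ⟨g, hg⟩ := hle (Equiv.Perm.mem_alternatingGroup.2 hσ)
  exact ⟨g, fun P => by rw [F.apply_smul, hg]⟩

/-- Hypothesis (2) of Thm. 8.3.2 from the certificate: a complex conjugation `c` has `c² = 1`, so
`perm c` is an involution; if it moves exactly four of the five Weierstrass points (one real root) it is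
a double transposition. [cite: BoxerCalegariGeePilloni2025, Thm. 8.3.2 (2)] -/
theorem hypothesisTwo_of_frame (F : WeierstrassTwoTorsionFrame A)
    (hcc : ∀ c : absoluteGaloisGroup ℚ, IsComplexConjugation (algebraMap ℚ ℝ) c →
      (F.perm c).support.card = 4) :
    ∀ c : absoluteGaloisGroup ℚ, IsComplexConjugation (algebraMap ℚ ℝ) c →
      ∃ σ : Perm (Fin 5), σ.cycleType = {2, 2} ∧
        ∀ P : A.geomTorsion (2 : ℕ), F.e (c • P) = s5bMatrix σ *ᵥ F.e P := by
  intro c hc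
  refine ⟨F.perm c, cycleType_eq_two_two_of_sq_eq_one ?_ (hcc c hc), F.apply_smul c⟩
  rw [← map_pow, hc.sq_eq_one, map_one]

/-- **VERDICT (mod-2 flag): a certified residually-`A₅(b)` surface is modular, GIVEN Thm. 8.3.2.**
For an abelian surface `A/ℚ` (`A.dim = 2`) with a Weierstrass `2`-torsion frame `F` (binder), a
Galois element acting by a `5`-cycle (`h5`), one acting with order `3` or `6` (`h36`), complex
conjugations moving exactly four Weierstrass points (`hcc`), and hypothesis (3) of Thm. 8.3.2 verbatim
(`hss`: semistable-or-good reduction at `2` in Galois form on every `V_ℓ(A)`, `ℓ ≠ 2`; `hord`: every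
framed dual of `V₂(A)` ordinary and `2`-distinguished at `v ∣ 2`), the named fact `h832` yields: every
framed dual `r` of every `V_p(A)` (`r(g) = [g⁻¹]_bᵀ`, the paper's `ρ_{A,p}` on `H¹`) is automorphic in
the tree's almost-everywhere `GL₄` sense `IsAutomorphicAE ι hcpt r`. CONDITIONAL on `h832` (a
published theorem, not proved in the tree); every datum is a binder.
[cite: BoxerCalegariGeePilloni2025, Thm. 8.3.2 p. 124; §8.1] -/
theorem modular_of_mod2Certificate (h832 : bcgp_residuallyA5b_modular_abelianSurface)
    (A : AbelianVariety ℚ) (hA : A.dim = 2) (F : WeierstrassTwoTorsionFrame A)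
    (h5 : ∃ g : absoluteGaloisGroup ℚ, F.perm g ^ 5 = 1 ∧ F.perm g ≠ 1)
    (h36 : ∃ g : absoluteGaloisGroup ℚ, F.perm g ^ 6 = 1 ∧ F.perm g ^ 2 ≠ 1)
    (hcc : ∀ c : absoluteGaloisGroup ℚ, IsComplexConjugation (algebraMap ℚ ℝ) c →
      (F.perm c).support.card = 4)
    (hss : ∀ (ℓ : ℕ) [Fact ℓ.Prime], ℓ ≠ 2 →
      ∀ v : HeightOneSpectrum (𝓞 ℚ), ((2 : ℕ) : 𝓞 ℚ) ∈ v.asIdeal →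
        ∀ τ ∈ absInertia (v.adicCompletion ℚ),
          (A.rationalTateRep ℓ (absGaloisRestrict ℚ (v.adicCompletion ℚ) τ) - 1) ^ 2 = 0)
    (hord : ∀ (b₂ : Module.Basis (Fin 4) ℚ_[2] (A.rationalTateModule 2))
        (r₂ : FramedGaloisRep ℚ (PadicAlgCl 2) 4),
        (∀ g : absoluteGaloisGroup ℚ,
          (r₂ g).val =
            ((LinearMap.toMatrix b₂ b₂ (A.rationalTateRep 2 g⁻¹)).map
              (algebraMap ℚ_[2] (PadicAlgCl 2))).transpose) →
        ∀ v : HeightOneSpectrum (𝓞 ℚ), ((2 : ℕ) : 𝓞 ℚ) ∈ v.asIdeal →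
          r₂.IsOrdinaryPDistinguishedAt v) :
    ∀ (p : ℕ) [Fact p.Prime] (b : Module.Basis (Fin 4) ℚ_[p] (A.rationalTateModule p))
      (r : FramedGaloisRep ℚ (PadicAlgCl p) 4),
      (∀ g : absoluteGaloisGroup ℚ,
        (r g).val =
          ((LinearMap.toMatrix b b (A.rationalTateRep p g⁻¹)).map
            (algebraMap ℚ_[p] (PadicAlgCl p))).transpose) →
      ∀ (hcpt : isCompact_glFiniteIntegralLevel 4 ℚ) (ι : PadicAlgCl p ≃+* ℂ),
        IsAutomorphicAE ι hcpt r := by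
  intro p _ b r hr hcpt ι
  obtain ⟨h1a, h1b⟩ := hypothesisOne_of_frame F h5 h36
  exact h832 A hA ⟨F.e, h1a, h1b, hypothesisTwo_of_frame F hcc⟩ hss hord p b r hr hcpt ι

end Certificate

end Summit.Ventures.ResidMod
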